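import Literature.Barriers.NavierStokesRegularity.NavierStokesInequalityInteractionDecay
import Literature.Barriers.NavierStokesRegularity.NavierStokesInequalityStructureRecipe
import Literature.Analysis.FluidPDE.NormalisedPressureAffine
import Literature.Analysis.FluidPDE.NormalisedPressureDisjointAdd
import Literature.Analysis.FluidPDE.NormalisedPressureCompactSupport
import HarnessLib

/-!
# Copies and disjoint sums of structures; the transformation laws of `F[v,f]` (Ożański 2017, §5.2)

Barrier catalogue support file for `NavierStokesRegularity` (D-0021), on the discharge path of
fact C′ `Literature.Barriers.NavierStokesRegularity.NSICantorArrangementExists` of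
`NavierStokesInequalityCantorArrangement` (and equally of fact C `NSIArrangementExists` of
`NavierStokesInequalityArrangement`): W. S. Ożański, arXiv:1709.00602v4, §5.2 "The copies of `U`
and its structure" and §5.4/(5.26), §6.5 Steps 2 and 4 — the whole geometric arrangement is
assembled from translated, dilated and amplified copies `U^{α,ρ}`,
`(v^{α,ρ,σ}, f^{α,ρ,σ}, φ^{α,ρ})` of ONE base structure and from sums of structures living on
sets with pairwise disjoint closures, and it is driven by the two laws
(5.11) `F^{α,ρ,σ}(x₁,x₂) = (σ²/ρ) F((x₁-α)/ρ, x₂/ρ)` and (5.26)/(6.5, Step 4)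
`F[v₁ + v₂ + …, f₁ + f₂ + …] = F[v₁,f₁] + F[v₂,f₂] + …` for the pressure interaction function
`F[v,f] = ∇p[0,f] - ∇p[v,f]` (3.34). (Scheffer 1987, §4: the maps `x ↦ εx + b` of (4.5)–(4.8)
and the sums (4.32)–(4.33).) Everything here is a `theorem`; the only definitions are the three
copy maps (and the plane homeomorphism packaging `copyInv`).

## Mathlib / tree search

`Homeomorph.preimage_closure`, `Homeomorph.isCompact_preimage`, `fderiv_const_mul`,
`Filter.EventuallyEq.fderiv_eq`, `Finset.closure_biUnion`, `Finset.induction_on` (used); tree: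
`normalisedPressure_smul_comp_affine` (`NormalisedPressureAffine`),
`normalisedPressure_add_of_disjoint_of_contDiff` (`NormalisedPressureDisjointAdd`),
`lintegral_enorm_sq_lt_top_of_hasCompactSupport`, `IsNSIStructure.contDiff_planePressure`,
`IsNSIStructure.swirlField_eq_zero`, `contDiff_one_derivR_derivZ` (used).

## Contents (tree coordinates: `q = (r, z)`, axis `= x̂₂`, Ożański's `(x₁, x₂) = (z, r)`)

* `copyInv α ρ q = (r/ρ, (z-α)/ρ)` (the inverse similarity), `copySet α ρ U = copyInv⁻¹(U)`
  (`= U^{α,ρ}`), `copyFun α ρ σ g = σ · g ∘ copyInv` (`f^{α,ρ,σ}`, and `φ^{α,ρ} = copyFun α ρ 1 φ`),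
  `copyVec α ρ σ v = σ · v ∘ copyInv` (`v^{α,ρ,σ}`), and on `ℝ³` the similarity
  `copyInv3 α ρ x = ρ⁻¹(x - α x̂₂)` with `R⁻¹ ∘ copyInv3 = copyInv ∘ R⁻¹`.
* `IsNSIStructure.copy`: **a copy of a structure is a structure** on `U^{α,ρ}` (`ρ, σ > 0`).
* `swirlField_copy`: `u[v^{α,ρ,σ}, f^{α,ρ,σ}] = σ u[v,f] ∘ copyInv3`;
  `planePressure_copy`: `p[v^{α,ρ,σ}, f^{α,ρ,σ}] = σ² p[v,f] ∘ copyInv`;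
  `IsNSIStructure.pressureInteraction_copy`: **(5.11)** `F^{α,ρ,σ} = (σ²/ρ) F ∘ copyInv`.
* `IsNSIStructure.add`: **the sum of two structures with disjoint closures is a structure** on
  the union; `IsNSIStructure.swirlField_add`, `IsNSIStructure.normalisedPressure_swirlField_add`,
  `IsNSIStructure.planePressure_add`, `IsNSIStructure.pressureInteraction_add`:
  **`F[v₁+v₂, f₁+f₂] = F[v₁,f₁] + F[v₂,f₂]`** (the pressure of a disjointly supported sum is the
  sum of the pressures, Lemma 3.2 (iii), the tree's `normalisedPressure_add_of_disjoint_of_contDiff`).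
* `IsNSIStructure.empty`, `IsNSIStructure.finsetSum`, `IsNSIStructure.pressureInteraction_finsetSum`:
  the finite versions used for the `M` translated clusters of §6.5, Step 4.

## References

* W. S. Ożański, arXiv:1709.00602v4 (2017/2019), §3.6 (3.34), Lemma 3.2 (iii), §5.2
  (5.8)–(5.11), §5.4 (5.26), §6.5 Steps 2 and 4. [`Ozanski2017NSISingular`]
* V. Scheffer, Comm. Math. Phys. 110 (1987), 525–551, §4 (4.5)–(4.8), (4.32)–(4.33).
  [`Scheffer1987`]
* V. Scheffer, Comm. Math. Phys. 101 (1985), 47–85, §4. [`Scheffer1985`]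
-/

noncomputable section

open MeasureTheory Set Function Filter Topology TopologicalSpace WithLp Metric
open scoped ENNReal InnerProductSpace RealInnerProductSpace ContDiff

namespace Literature.Barriers.NavierStokesRegularity

open Literature.Analysis.FluidPDE

/-- Local notation for physical space `ℝ³ = EuclideanSpace ℝ (Fin 3)`. -/
local notation "ℝ³" => EuclideanSpace ℝ (Fin 3)

/-! ### The copy maps -/

/-- The inverse similarity of a copy: `copyInv α ρ (r, z) = (r/ρ, (z - α)/ρ)` (Ożański (5.8):
`U^{α,ρ} = {x : ((x₁-α)/ρ, x₂/ρ) ∈ U}`, axial translation by `α`, dilation by `ρ`).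
[cite: Ozanski2017NSISingular, §5.2 (5.8)] -/
def copyInv (α ρ : ℝ) (q : ℝ × ℝ) : ℝ × ℝ :=
  (q.1 / ρ, (q.2 - α) / ρ)

/-- **The copy `U^{α,ρ}`** of a planar set (Ożański (5.8)). [cite: Ozanski2017NSISingular, §5.2 (5.8)] -/
def copySet (α ρ : ℝ) (U : Set (ℝ × ℝ)) : Set (ℝ × ℝ) :=
  copyInv α ρ ⁻¹' U

/-- **The copy `g^{α,ρ,σ} = σ g((·-α)/ρ)`** of a planar scalar (Ożański (5.9) for `f`, (5.10) with
`σ = 1` for `φ`). [cite: Ozanski2017NSISingular, §5.2 (5.9)–(5.10)] -/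
def copyFun (α ρ σ : ℝ) (g : ℝ × ℝ → ℝ) (q : ℝ × ℝ) : ℝ :=
  σ * g (copyInv α ρ q)

/-- **The copy `v^{α,ρ,σ} = σ v((·-α)/ρ)`** of a planar field (Ożański (5.9)).
[cite: Ozanski2017NSISingular, §5.2 (5.9)] -/
def copyVec (α ρ σ : ℝ) (v : ℝ × ℝ → ℝ × ℝ) (q : ℝ × ℝ) : ℝ × ℝ :=
  σ • v (copyInv α ρ q)

/-- The similarity of `ℝ³` over `copyInv`: `copyInv3 α ρ x = ρ⁻¹ (x - α x̂₂)`. [folklore] -/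
def copyInv3 (α ρ : ℝ) (x : ℝ³) : ℝ³ :=
  ρ⁻¹ • (x - α • eZ)

/-- Unfolding `copyInv`. [folklore] -/
@[simp] theorem copyInv_apply (α ρ : ℝ) (q : ℝ × ℝ) :
    copyInv α ρ q = (q.1 / ρ, (q.2 - α) / ρ) := rfl

/-- Membership in a copy `U^{α,ρ}`. [folklore] -/
@[simp] theorem mem_copySet {α ρ : ℝ} {U : Set (ℝ × ℝ)} {q : ℝ × ℝ} :
    q ∈ copySet α ρ U ↔ copyInv α ρ q ∈ U := Iff.rfl

/-- Unfolding `copyFun`. [folklore] -/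
@[simp] theorem copyFun_apply (α ρ σ : ℝ) (g : ℝ × ℝ → ℝ) (q : ℝ × ℝ) :
    copyFun α ρ σ g q = σ * g (copyInv α ρ q) := rfl

/-- Unfolding `copyVec`. [folklore] -/
@[simp] theorem copyVec_apply (α ρ σ : ℝ) (v : ℝ × ℝ → ℝ × ℝ) (q : ℝ × ℝ) :
    copyVec α ρ σ v q = σ • v (copyInv α ρ q) := rfl

/-- `v^{α,ρ,σ}` of the zero field is zero. [folklore] -/
@[simp] theorem copyVec_zero (α ρ σ : ℝ) : copyVec α ρ σ (0 : ℝ × ℝ → ℝ × ℝ) = 0 := by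
  funext q; simp [copyVec]

/-- The copy with `α = 0`, `ρ = σ = 1` is the identity. [folklore] -/
@[simp] theorem copyInv_zero_one : copyInv 0 1 = id := by
  funext q; simp [copyInv]

/-- The similarity `copyMap α ρ (r, z) = (ρ r, ρ z + α)` and its inverse `copyInv` as a
homeomorphism of the plane (`ρ ≠ 0`). [folklore] -/
def copyHomeomorph (α ρ : ℝ) (hρ : ρ ≠ 0) : ℝ × ℝ ≃ₜ ℝ × ℝ where
  toFun := copyInv α ρ
  invFun q := (ρ * q.1, ρ * q.2 + α)
  left_inv q := by
    obtain ⟨r, z⟩ := q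
    simp only [copyInv_apply, Prod.mk.injEq]
    constructor
    · field_simp
    · field_simp
      ring
  right_inv q := by
    obtain ⟨r, z⟩ := q
    simp only [copyInv_apply, Prod.mk.injEq]
    constructor
    · field_simp
    · field_simp
      ring
  continuous_toFun :=
    (continuous_fst.div_const ρ).prodMk ((continuous_snd.sub continuous_const).div_const ρ)
  continuous_invFun :=
    (continuous_const.mul continuous_fst).prodMk ((continuous_const.mul continuous_snd).add
      continuous_const)

/-- The homeomorphism acts as `copyInv`. [folklore] -/
@[simp] theorem copyHomeomorph_apply (α ρ : ℝ) (hρ : ρ ≠ 0) (q : ℝ × ℝ) :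
    copyHomeomorph α ρ hρ q = copyInv α ρ q := rfl

/-- `copyInv` is an affine map with linear part `ρ⁻¹ · id`. [folklore] -/
theorem copyInv_eq (α ρ : ℝ) (q : ℝ × ℝ) :
    copyInv α ρ q = ρ⁻¹ • q + (0, -α / ρ) := by
  obtain ⟨r, z⟩ := q
  simp only [copyInv_apply, Prod.smul_mk, smul_eq_mul, Prod.mk_add_mk, add_zero, Prod.mk.injEq]
  constructor <;> ring

/-- The derivative of `copyInv` is `ρ⁻¹ · id`. [folklore] -/
theorem hasFDerivAt_copyInv (α ρ : ℝ) (q : ℝ × ℝ) :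
    HasFDerivAt (copyInv α ρ) (ρ⁻¹ • ContinuousLinearMap.id ℝ (ℝ × ℝ)) q := by
  have h : copyInv α ρ = fun q => ρ⁻¹ • q + (0, -α / ρ) := funext (copyInv_eq α ρ)
  rw [h]
  exact ((ContinuousLinearMap.id ℝ (ℝ × ℝ)).hasFDerivAt.const_smul ρ⁻¹).add_const _

/-- `copyInv` is smooth. [folklore] -/
theorem contDiff_copyInv (α ρ : ℝ) {n : WithTop ℕ∞} : ContDiff ℝ n (copyInv α ρ) :=
  (contDiff_fst.div_const ρ).prodMk ((contDiff_snd.sub contDiff_const).div_const ρ)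

/-- **Chain rule for the planar partials along a copy**: `∂ᵣ(g ∘ copyInv)(q) = ρ⁻¹ ∂ᵣ g (copyInv q)`
at points where `g` is differentiable. [folklore] -/
theorem derivR_comp_copyInv {F : Type*} [NormedAddCommGroup F] [NormedSpace ℝ F] {g : ℝ × ℝ → F}
    {α ρ : ℝ} {q : ℝ × ℝ} (hg : DifferentiableAt ℝ g (copyInv α ρ q)) :
    derivR (fun q' => g (copyInv α ρ q')) q = ρ⁻¹ • derivR g (copyInv α ρ q) := by
  rw [derivR, derivR, show (fun q' => g (copyInv α ρ q')) = g ∘ copyInv α ρ from rfl,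
    fderiv_comp q hg (hasFDerivAt_copyInv α ρ q).differentiableAt,
    (hasFDerivAt_copyInv α ρ q).fderiv]
  simp

/-- `∂_z(g ∘ copyInv)(q) = ρ⁻¹ ∂_z g (copyInv q)`. [folklore] -/
theorem derivZ_comp_copyInv {F : Type*} [NormedAddCommGroup F] [NormedSpace ℝ F] {g : ℝ × ℝ → F}
    {α ρ : ℝ} {q : ℝ × ℝ} (hg : DifferentiableAt ℝ g (copyInv α ρ q)) :
    derivZ (fun q' => g (copyInv α ρ q')) q = ρ⁻¹ • derivZ g (copyInv α ρ q) := by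
  rw [derivZ, derivZ, show (fun q' => g (copyInv α ρ q')) = g ∘ copyInv α ρ from rfl,
    fderiv_comp q hg (hasFDerivAt_copyInv α ρ q).differentiableAt,
    (hasFDerivAt_copyInv α ρ q).fderiv]
  simp

/-- `∂ᵣ(c · g ∘ copyInv)(q) = c ρ⁻¹ ∂ᵣ g (copyInv q)` for real `g`. [folklore] -/
theorem derivR_const_mul_comp_copyInv {g : ℝ × ℝ → ℝ} {α ρ : ℝ} (c : ℝ) {q : ℝ × ℝ}
    (hg : DifferentiableAt ℝ g (copyInv α ρ q)) :
    derivR (fun q' => c * g (copyInv α ρ q')) q = c * ρ⁻¹ * derivR g (copyInv α ρ q) := by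
  have hd : DifferentiableAt ℝ (fun q'' => g (copyInv α ρ q'')) q :=
    hg.comp q (hasFDerivAt_copyInv α ρ q).differentiableAt
  rw [derivR, fderiv_const_mul hd c, _root_.smul_apply,
    show fderiv ℝ (fun q'' => g (copyInv α ρ q'')) q (1, 0) =
      derivR (fun q'' => g (copyInv α ρ q'')) q from rfl, derivR_comp_copyInv hg]
  simp [mul_assoc]

/-- `∂_z(c · g ∘ copyInv)(q) = c ρ⁻¹ ∂_z g (copyInv q)` for real `g`. [folklore] -/
theorem derivZ_const_mul_comp_copyInv {g : ℝ × ℝ → ℝ} {α ρ : ℝ} (c : ℝ) {q : ℝ × ℝ}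
    (hg : DifferentiableAt ℝ g (copyInv α ρ q)) :
    derivZ (fun q' => c * g (copyInv α ρ q')) q = c * ρ⁻¹ * derivZ g (copyInv α ρ q) := by
  have hd : DifferentiableAt ℝ (fun q'' => g (copyInv α ρ q'')) q :=
    hg.comp q (hasFDerivAt_copyInv α ρ q).differentiableAt
  rw [derivZ, fderiv_const_mul hd c, _root_.smul_apply,
    show fderiv ℝ (fun q'' => g (copyInv α ρ q'')) q (0, 1) =
      derivZ (fun q'' => g (copyInv α ρ q'')) q from rfl, derivZ_comp_copyInv hg]
  simp [mul_assoc]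

/-! ### Supports and closures under the copy maps -/

/-- `closure (U^{α,ρ}) = (Ū)^{α,ρ}`. [folklore] -/
theorem closure_copySet (α : ℝ) {ρ : ℝ} (hρ : ρ ≠ 0) (U : Set (ℝ × ℝ)) :
    closure (copySet α ρ U) = copySet α ρ (closure U) :=
  ((copyHomeomorph α ρ hρ).preimage_closure U).symm

/-- `supp g^{α,ρ,σ} = (supp g)^{α,ρ}` for `σ ≠ 0`. [folklore] -/
theorem support_copyFun (α ρ : ℝ) {σ : ℝ} (hσ : σ ≠ 0) (g : ℝ × ℝ → ℝ) :
    support (copyFun α ρ σ g) = copyInv α ρ ⁻¹' support g := by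
  ext q; simp [mem_support, hσ]

/-- `tsupport g^{α,ρ,σ} = (tsupport g)^{α,ρ}` for `ρ, σ ≠ 0`. [folklore] -/
theorem tsupport_copyFun (α : ℝ) {ρ σ : ℝ} (hρ : ρ ≠ 0) (hσ : σ ≠ 0) (g : ℝ × ℝ → ℝ) :
    tsupport (copyFun α ρ σ g) = copyInv α ρ ⁻¹' tsupport g := by
  rw [tsupport, support_copyFun α ρ hσ, tsupport]
  exact ((copyHomeomorph α ρ hρ).preimage_closure _).symm

/-- `supp v^{α,ρ,σ} = (supp v)^{α,ρ}` for `σ ≠ 0`. [folklore] -/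
theorem support_copyVec (α ρ : ℝ) {σ : ℝ} (hσ : σ ≠ 0) (v : ℝ × ℝ → ℝ × ℝ) :
    support (copyVec α ρ σ v) = copyInv α ρ ⁻¹' support v := by
  ext q; simp [mem_support, hσ]

/-- `tsupport v^{α,ρ,σ} = (tsupport v)^{α,ρ}` for `ρ, σ ≠ 0`. [folklore] -/
theorem tsupport_copyVec (α : ℝ) {ρ σ : ℝ} (hρ : ρ ≠ 0) (hσ : σ ≠ 0) (v : ℝ × ℝ → ℝ × ℝ) :
    tsupport (copyVec α ρ σ v) = copyInv α ρ ⁻¹' tsupport v := by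
  rw [tsupport, support_copyVec α ρ hσ, tsupport]
  exact ((copyHomeomorph α ρ hρ).preimage_closure _).symm

/-- `r = ρ · (copyInv q).1`. [folklore] -/
theorem fst_eq_mul_copyInv_fst {ρ : ℝ} (hρ : ρ ≠ 0) (α : ℝ) (q : ℝ × ℝ) :
    q.1 = ρ * (copyInv α ρ q).1 := by
  simp only [copyInv_apply]; field_simp

/-! ### Derivatives of copies: `∂`, `L`, `div` -/

/-- `∂ᵣ g^{α,ρ,σ} = (σ/ρ) (∂ᵣ g)^{α,ρ,1}` for differentiable `g`. [folklore] -/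
theorem derivR_copyFun {g : ℝ × ℝ → ℝ} (hg : Differentiable ℝ g) (α ρ σ : ℝ) :
    derivR (copyFun α ρ σ g) = fun q => σ * ρ⁻¹ * derivR g (copyInv α ρ q) := by
  funext q
  exact derivR_const_mul_comp_copyInv σ (hg _)

/-- `∂_z g^{α,ρ,σ} = (σ/ρ) (∂_z g)^{α,ρ,1}` for differentiable `g`. [folklore] -/
theorem derivZ_copyFun {g : ℝ × ℝ → ℝ} (hg : Differentiable ℝ g) (α ρ σ : ℝ) :
    derivZ (copyFun α ρ σ g) = fun q => σ * ρ⁻¹ * derivZ g (copyInv α ρ q) := by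
  funext q
  exact derivZ_const_mul_comp_copyInv σ (hg _)

/-- **`L` commutes with copies up to the factor `σ/ρ²`**: `L(g^{α,ρ,σ})(q) = (σ/ρ²)(Lg)(copyInv q)`
for `g ∈ C²` (Ożański §5.2: "(`v^{α,ρ,σ}, f^{α,ρ,σ}, φ^{α,ρ}`) is a structure on `U^{α,ρ}`" — the
operator `L = Δ + r⁻¹∂ᵣ - r⁻²` is homogeneous of degree `-2` under the dilation and invariant under
axial translations). [cite: Ozanski2017NSISingular, §5.2 (after (5.11))] -/
theorem opL_copyFun {g : ℝ × ℝ → ℝ} (hg : ContDiff ℝ 2 g) (α : ℝ) {ρ : ℝ} (hρ : ρ ≠ 0) (σ : ℝ)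
    (q : ℝ × ℝ) : opL (copyFun α ρ σ g) q = σ / ρ ^ 2 * opL g (copyInv α ρ q) := by
  have hg1 : Differentiable ℝ g := hg.differentiable (by decide)
  have hdR : Differentiable ℝ (derivR g) :=
    (contDiff_one_derivR_derivZ hg).1.differentiable one_ne_zero
  have hdZ : Differentiable ℝ (derivZ g) :=
    (contDiff_one_derivR_derivZ hg).2.differentiable one_ne_zero
  have h1 : derivR (derivR (copyFun α ρ σ g)) q = σ * ρ⁻¹ * ρ⁻¹ * derivR (derivR g) (copyInv α ρ q) := by
    rw [derivR_copyFun hg1, derivR_const_mul_comp_copyInv _ (hdR _)]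
  have h2 : derivZ (derivZ (copyFun α ρ σ g)) q = σ * ρ⁻¹ * ρ⁻¹ * derivZ (derivZ g) (copyInv α ρ q) := by
    rw [derivZ_copyFun hg1, derivZ_const_mul_comp_copyInv _ (hdZ _)]
  have h3 : derivR (copyFun α ρ σ g) q = σ * ρ⁻¹ * derivR g (copyInv α ρ q) := by
    rw [derivR_copyFun hg1]
  have hq : q.1 = ρ * (copyInv α ρ q).1 := fst_eq_mul_copyInv_fst hρ α q
  simp only [opL]
  rw [h1, h2, h3, copyFun_apply, hq]
  set p := copyInv α ρ q
  rcases eq_or_ne p.1 0 with hp | hp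
  · simp only [hp, mul_zero, inv_zero, zero_mul, ne_eq, OfNat.ofNat_ne_zero, not_false_eq_true,
      zero_pow, div_zero, add_zero, sub_zero]
    field_simp
  · field_simp

/-- **`div(r v^{α,ρ,σ})(q) = σ · div(r v)(copyInv q)`** for differentiable `v` (the weighted
divergence is dilation-covariant and invariant under axial translation; Ożański §5.2).
[cite: Ozanski2017NSISingular, §5.2 (after (5.11))] -/
theorem div_copyVec {v : ℝ × ℝ → ℝ × ℝ} (hv : Differentiable ℝ v) (α : ℝ) {ρ : ℝ} (hρ : ρ ≠ 0)
    (σ : ℝ) (q : ℝ × ℝ) :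
    derivR (fun q' : ℝ × ℝ => q'.1 * (copyVec α ρ σ v q').1) q +
        derivZ (fun q' : ℝ × ℝ => q'.1 * (copyVec α ρ σ v q').2) q =
      σ * (derivR (fun q' : ℝ × ℝ => q'.1 * (v q').1) (copyInv α ρ q) +
        derivZ (fun q' : ℝ × ℝ => q'.1 * (v q').2) (copyInv α ρ q)) := by
  have hG₁ : Differentiable ℝ fun q' : ℝ × ℝ => q'.1 * (v q').1 :=
    differentiable_fst.mul (differentiable_fst.comp hv)
  have hG₂ : Differentiable ℝ fun q' : ℝ × ℝ => q'.1 * (v q').2 :=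
    differentiable_fst.mul (differentiable_snd.comp hv)
  have e₁ : (fun q' : ℝ × ℝ => q'.1 * (copyVec α ρ σ v q').1) =
      fun q' => (σ * ρ) * ((copyInv α ρ q').1 * (v (copyInv α ρ q')).1) := by
    funext q'
    rw [fst_eq_mul_copyInv_fst hρ α q']
    simp only [copyVec_apply, Prod.smul_fst, smul_eq_mul, copyInv_apply]
    ring
  have e₂ : (fun q' : ℝ × ℝ => q'.1 * (copyVec α ρ σ v q').2) =
      fun q' => (σ * ρ) * ((copyInv α ρ q').1 * (v (copyInv α ρ q')).2) := by
    funext q'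
    rw [fst_eq_mul_copyInv_fst hρ α q']
    simp only [copyVec_apply, Prod.smul_snd, smul_eq_mul, copyInv_apply]
    ring
  rw [e₁, e₂, derivR_const_mul_comp_copyInv _ (hG₁ _), derivZ_const_mul_comp_copyInv _ (hG₂ _)]
  field_simp

/-- Copies of smooth scalars are smooth. [folklore] -/
theorem contDiff_copyFun {g : ℝ × ℝ → ℝ} {n : WithTop ℕ∞} (hg : ContDiff ℝ n g) (α ρ σ : ℝ) :
    ContDiff ℝ n (copyFun α ρ σ g) :=
  contDiff_const.mul (hg.comp (contDiff_copyInv α ρ))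

/-- Copies of smooth fields are smooth. [folklore] -/
theorem contDiff_copyVec {v : ℝ × ℝ → ℝ × ℝ} {n : WithTop ℕ∞} (hv : ContDiff ℝ n v) (α ρ σ : ℝ) :
    ContDiff ℝ n (copyVec α ρ σ v) := by
  have h1 : ContDiff ℝ n fun q => v (copyInv α ρ q) := hv.comp (contDiff_copyInv α ρ)
  exact (contDiff_const (c := σ)).smul h1

/-! ### A copy of a structure is a structure -/

namespace IsNSIStructure

variable {U : Set (ℝ × ℝ)} {v : ℝ × ℝ → ℝ × ℝ} {f φ : ℝ × ℝ → ℝ}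

/-- **A copy of a structure is a structure** (Ożański 2017, §5.2: "A direct consequence of the
definitions above is that `U^{α,ρ} ⋐ P`, (`v^{α,ρ,σ}, f^{α,ρ,σ}, φ^{α,ρ}`) is a structure on
`U^{α,ρ}`"; Scheffer 1987, (4.5)–(4.8)). Here `α ∈ ℝ` (axial translation), `ρ > 0` (dilation),
`σ > 0` (amplitude). [cite: Ozanski2017NSISingular, §5.2 (5.8)–(5.11)] [cite: Scheffer1987, §4 (4.5)–(4.8)] -/
theorem copy (h : IsNSIStructure U v f φ) (α : ℝ) {ρ σ : ℝ} (hρ : 0 < ρ) (hσ : 0 < σ) :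
    IsNSIStructure (copySet α ρ U) (copyVec α ρ σ v) (copyFun α ρ σ f) (copyFun α ρ 1 φ) := by
  have hρ' : ρ ≠ 0 := hρ.ne'
  have hσ' : σ ≠ 0 := hσ.ne'
  set e := copyHomeomorph α ρ hρ'
  have hcl : closure (copySet α ρ U) = copyInv α ρ ⁻¹' closure U := closure_copySet α hρ' U
  have hf2 : ContDiff ℝ 2 f := h.f_smooth.of_le (by norm_cast)
  refine
    { isOpen := h.isOpen.preimage e.continuous
      isCompact_closure := ?_
      closure_subset := ?_
      v_smooth := contDiff_copyVec h.v_smooth α ρ σ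
      f_smooth := contDiff_copyFun h.f_smooth α ρ σ
      φ_smooth := contDiff_copyFun h.φ_smooth α ρ 1
      f_nonneg := fun q => mul_nonneg hσ.le (h.f_nonneg _)
      φ_mem := fun q => by simpa [copyFun] using h.φ_mem (copyInv α ρ q)
      tsupport_f := by rw [tsupport_copyFun α hρ' hσ', h.tsupport_f, hcl]
      tsupport_φ := by rw [tsupport_copyFun α hρ' one_ne_zero]; exact preimage_mono h.tsupport_φ
      tsupport_v := by
        rw [tsupport_copyVec α hρ' hσ']
        intro q hq
        have := h.tsupport_v hq
        simpa [copyFun] using this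
      div_eq_zero := fun q hq => by
        rw [div_copyVec (h.v_smooth.differentiable (by simp)) α hρ' σ q, h.div_eq_zero _ hq,
          mul_zero]
      sq_lt := fun q hq => ?_
      opL_pos := fun q hq hφ => ?_ }
  · rw [hcl]
    exact (e.isCompact_preimage).2 h.isCompact_closure
  · intro q hq
    rw [hcl] at hq
    have h1 : 0 < (copyInv α ρ q).1 := h.closure_subset hq
    simp only [copyInv_apply] at h1
    exact (div_pos_iff_of_pos_right hρ).1 h1
  · have := h.sq_lt _ hq
    simp only [copyFun_apply, copyVec_apply, Prod.smul_fst, Prod.smul_snd, smul_eq_mul]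
    nlinarith [mul_pos hσ hσ]
  · have hφ' : φ (copyInv α ρ q) ≠ 1 := by simpa [copyFun] using hφ
    rw [opL_copyFun hf2 α hρ' σ q]
    exact mul_pos (div_pos hσ (pow_pos hρ 2)) (h.opL_pos _ hq hφ')

end IsNSIStructure

/-! ### The fields, pressures and interaction functions of copies -/

/-- Axial translations and dilations do not change the distance to the axis, up to the factor:
`cylRadius (copyInv3 α ρ x) = ρ⁻¹ cylRadius x` (`ρ > 0`). [folklore] -/
theorem cylRadius_copyInv3 (α : ℝ) {ρ : ℝ} (hρ : 0 < ρ) (x : ℝ³) :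
    cylRadius (copyInv3 α ρ x) = ρ⁻¹ * cylRadius x := by
  rw [copyInv3, cylRadius_smul, abs_of_pos (inv_pos.2 hρ)]
  congr 1
  simp [cylRadius, eZ]

/-- **`R⁻¹ ∘ copyInv3 = copyInv ∘ R⁻¹`** (`ρ > 0`). [folklore] -/
theorem meridian_copyInv3 (α : ℝ) {ρ : ℝ} (hρ : 0 < ρ) (x : ℝ³) :
    meridian (copyInv3 α ρ x) = copyInv α ρ (meridian x) := by
  rw [meridian_apply, cylRadius_copyInv3 α hρ x, meridian_apply, copyInv_apply]
  simp only [Prod.mk.injEq]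
  constructor
  · rw [div_eq_inv_mul]
  · simp [copyInv3, eZ, sub_eq_add_neg]
    ring

/-- `copyInv3` maps meridian points to meridian points: `copyInv3 (r,0,z) = (r/ρ, 0, (z-α)/ρ)`.
[folklore] -/
theorem copyInv3_meridianPoint (α ρ : ℝ) (q : ℝ × ℝ) :
    copyInv3 α ρ (meridianPoint q) = meridianPoint (copyInv α ρ q) := by
  ext i
  fin_cases i <;> simp [copyInv3, meridianPoint, eZ, div_eq_inv_mul, mul_sub]

/-- `copyInv3` as the affine map `y ↦ x₀ + ρ⁻¹ y`, `x₀ = -(α/ρ) x̂₂`. [folklore] -/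
theorem copyInv3_eq (α ρ : ℝ) (x : ℝ³) :
    copyInv3 α ρ x = -(ρ⁻¹ * α) • eZ + ρ⁻¹ • x := by
  simp only [copyInv3, smul_sub, smul_smul, neg_smul]
  abel

/-- The radial frame vector is invariant under the similarity: `ρ̂(copyInv3 x) = ρ̂(x)` (`ρ > 0`).
[folklore] -/
theorem eR_copyInv3 (α : ℝ) {ρ : ℝ} (hρ : 0 < ρ) (x : ℝ³) : eR (copyInv3 α ρ x) = eR x := by
  have hr := cylRadius_copyInv3 α hρ x
  rcases eq_or_ne (cylRadius x) 0 with h0 | h0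
  · have h0' : cylRadius (copyInv3 α ρ x) = 0 := by rw [hr, h0, mul_zero]
    simp [eR, h0, h0']
  · have hc0 : (copyInv3 α ρ x) 0 = ρ⁻¹ * x 0 := by simp [copyInv3, eZ]
    have hc1 : (copyInv3 α ρ x) 1 = ρ⁻¹ * x 1 := by simp [copyInv3, eZ]
    have hρ' : ρ ≠ 0 := hρ.ne'
    ext i
    fin_cases i <;> simp [eR, hr, hc0, hc1] <;> field_simp

/-- The angular frame vector is invariant under the similarity: `φ̂(copyInv3 x) = φ̂(x)` (`ρ > 0`).
[folklore] -/
theorem eTheta_copyInv3 (α : ℝ) {ρ : ℝ} (hρ : 0 < ρ) (x : ℝ³) :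
    eTheta (copyInv3 α ρ x) = eTheta x := by
  have hr := cylRadius_copyInv3 α hρ x
  rcases eq_or_ne (cylRadius x) 0 with h0 | h0
  · have h0' : cylRadius (copyInv3 α ρ x) = 0 := by rw [hr, h0, mul_zero]
    simp [eTheta, h0, h0']
  · have hc0 : (copyInv3 α ρ x) 0 = ρ⁻¹ * x 0 := by simp [copyInv3, eZ]
    have hc1 : (copyInv3 α ρ x) 1 = ρ⁻¹ * x 1 := by simp [copyInv3, eZ]
    have hρ' : ρ ≠ 0 := hρ.ne'
    ext i
    fin_cases i <;> simp [eTheta, hr, hc0, hc1] <;> field_simp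

/-- **The field of a copy**: `u[v^{α,ρ,σ}, f^{α,ρ,σ}] = σ · u[v,f] ∘ copyInv3` (`ρ > 0`, `σ ≥ 0`;
Ożański §5.2 with (3.10): the copy of the structure generates the translated, dilated and
amplified field). [cite: Ozanski2017NSISingular, §5.2 (5.9)–(5.11)] -/
theorem swirlField_copy (v : ℝ × ℝ → ℝ × ℝ) (f : ℝ × ℝ → ℝ) (α : ℝ) {ρ σ : ℝ} (hρ : 0 < ρ)
    (hσ : 0 ≤ σ) :
    swirlField (copyVec α ρ σ v) (copyFun α ρ σ f) = fun x => σ • swirlField v f (copyInv3 α ρ x) := by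
  funext x
  have hm := meridian_copyInv3 α hρ x
  simp only [swirlField, hm, eR_copyInv3 α hρ, eTheta_copyInv3 α hρ, copyVec_apply, copyFun_apply,
    Prod.smul_fst, Prod.smul_snd, smul_eq_mul, smul_add, smul_smul]
  congr 1
  have h1 : (σ * f (copyInv α ρ (meridian x))) ^ 2 -
      ((σ * (v (copyInv α ρ (meridian x))).1) ^ 2 + (σ * (v (copyInv α ρ (meridian x))).2) ^ 2) =
      σ ^ 2 * (f (copyInv α ρ (meridian x)) ^ 2 -
        ((v (copyInv α ρ (meridian x))).1 ^ 2 + (v (copyInv α ρ (meridian x))).2 ^ 2)) := by ring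
  rw [h1, Real.sqrt_mul (sq_nonneg σ), Real.sqrt_sq hσ]

/-- **The pressure function of a copy**: `p*[σ u[v,f] ∘ copyInv3] = σ² p*[u[v,f]] ∘ copyInv3` (the
affine covariance and 2-homogeneity of the normalised pressure, `NormalisedPressureAffine`).
[cite: Ozanski2017NSISingular, §5.2 (5.11)] -/
theorem normalisedPressure_swirlField_copy (v : ℝ × ℝ → ℝ × ℝ) (f : ℝ × ℝ → ℝ) (α : ℝ) {ρ σ : ℝ}
    (hρ : 0 < ρ) (hσ : 0 ≤ σ) (x : ℝ³) :
    normalisedPressure (swirlField (copyVec α ρ σ v) (copyFun α ρ σ f)) x =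
      σ ^ 2 * normalisedPressure (swirlField v f) (copyInv3 α ρ x) := by
  have hγ : (0 : ℝ) < ρ⁻¹ := inv_pos.2 hρ
  have h1 : swirlField (copyVec α ρ σ v) (copyFun α ρ σ f) =
      fun y => σ • swirlField v f (-(ρ⁻¹ * α) • eZ + ρ⁻¹ • y) := by
    rw [swirlField_copy v f α hρ hσ]
    funext y
    rw [copyInv3_eq]
  rw [h1, normalisedPressure_smul_comp_affine (swirlField v f) (-(ρ⁻¹ * α) • eZ) σ hγ x,
    ← copyInv3_eq]

/-- **The planar pressure of a copy**: `p[v^{α,ρ,σ}, f^{α,ρ,σ}] = σ² p[v,f] ∘ copyInv`.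
[cite: Ozanski2017NSISingular, §5.2 (5.11)] -/
theorem planePressure_copy (v : ℝ × ℝ → ℝ × ℝ) (f : ℝ × ℝ → ℝ) (α : ℝ) {ρ σ : ℝ} (hρ : 0 < ρ)
    (hσ : 0 ≤ σ) :
    planePressure (copyVec α ρ σ v) (copyFun α ρ σ f) = copyFun α ρ (σ ^ 2) (planePressure v f) := by
  funext q
  rw [planePressure, normalisedPressure_swirlField_copy v f α hρ hσ, copyInv3_meridianPoint,
    copyFun_apply, planePressure]

/-- The planar pressure `p[0, f^{α,ρ,σ}]` of the pure swirl of a copy. [cite: Ozanski2017NSISingular, §5.2 (5.11)] -/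
theorem planePressure_zero_copy (f : ℝ × ℝ → ℝ) (α : ℝ) {ρ σ : ℝ} (hρ : 0 < ρ) (hσ : 0 ≤ σ) :
    planePressure 0 (copyFun α ρ σ f) = copyFun α ρ (σ ^ 2) (planePressure 0 f) := by
  have h := planePressure_copy 0 f α hρ hσ
  rwa [copyVec_zero] at h

namespace IsNSIStructure

variable {U : Set (ℝ × ℝ)} {v : ℝ × ℝ → ℝ × ℝ} {f φ : ℝ × ℝ → ℝ}

/-- **Ożański's (5.11): the pressure interaction function of a copy**,
`F^{α,ρ,σ} = F[v^{α,ρ,σ}, f^{α,ρ,σ}] = (σ²/ρ) F[v,f] ∘ copyInv`, i.e.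
`F^{α,ρ,σ}(x₁,x₂) = (σ²/ρ) F((x₁-α)/ρ, x₂/ρ)` (Scheffer 1987, (4.8)).
[cite: Ozanski2017NSISingular, §5.2 (5.11)] [cite: Scheffer1987, §4 (4.8)] -/
theorem pressureInteraction_copy (h : IsNSIStructure U v f φ) (α : ℝ) {ρ σ : ℝ} (hρ : 0 < ρ)
    (hσ : 0 ≤ σ) :
    pressureInteraction (copyVec α ρ σ v) (copyFun α ρ σ f) =
      fun q => (σ ^ 2 / ρ) • pressureInteraction v f (copyInv α ρ q) := by
  have hd₀ : Differentiable ℝ (planePressure 0 f) :=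
    h.contDiff_planePressure_zero.differentiable (by simp)
  have hd : Differentiable ℝ (planePressure v f) := h.contDiff_planePressure.differentiable (by simp)
  funext q
  rw [pressureInteraction, pressureInteraction, planePressure_copy v f α hρ hσ,
    planePressure_zero_copy f α hρ hσ, derivR_copyFun hd₀, derivR_copyFun hd, derivZ_copyFun hd₀,
    derivZ_copyFun hd]
  simp only [Prod.smul_mk, smul_eq_mul, div_eq_mul_inv, Prod.mk.injEq]
  constructor <;> ring

end IsNSIStructure

/-! ### Local congruence of the planar operators -/

/-- Functions agreeing on an open set have the same `∂ᵣ` there. [folklore] -/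
theorem derivR_congr_of_eqOn {F : Type*} [NormedAddCommGroup F] [NormedSpace ℝ F]
    {g₁ g₂ : ℝ × ℝ → F} {O : Set (ℝ × ℝ)} (hO : IsOpen O) (h : EqOn g₁ g₂ O) :
    EqOn (derivR g₁) (derivR g₂) O := fun _ hq =>
  congrArg (fun L : ℝ × ℝ →L[ℝ] F => L (1, 0)) (h.eventuallyEq_of_mem (hO.mem_nhds hq)).fderiv_eq

/-- Functions agreeing on an open set have the same `∂_z` there. [folklore] -/
theorem derivZ_congr_of_eqOn {F : Type*} [NormedAddCommGroup F] [NormedSpace ℝ F]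
    {g₁ g₂ : ℝ × ℝ → F} {O : Set (ℝ × ℝ)} (hO : IsOpen O) (h : EqOn g₁ g₂ O) :
    EqOn (derivZ g₁) (derivZ g₂) O := fun _ hq =>
  congrArg (fun L : ℝ × ℝ →L[ℝ] F => L (0, 1)) (h.eventuallyEq_of_mem (hO.mem_nhds hq)).fderiv_eq

/-- Functions agreeing on an open set have the same `L` there (`L` is a local operator). [folklore] -/
theorem opL_congr_of_eqOn {g₁ g₂ : ℝ × ℝ → ℝ} {O : Set (ℝ × ℝ)} (hO : IsOpen O) (h : EqOn g₁ g₂ O)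
    {q : ℝ × ℝ} (hq : q ∈ O) : opL g₁ q = opL g₂ q := by
  simp only [opL]
  rw [derivR_congr_of_eqOn hO (derivR_congr_of_eqOn hO h) hq,
    derivZ_congr_of_eqOn hO (derivZ_congr_of_eqOn hO h) hq, derivR_congr_of_eqOn hO h hq, h hq]

/-! ### Sums of two structures on sets with disjoint closures -/

namespace IsNSIStructure

variable {U₁ U₂ : Set (ℝ × ℝ)} {v₁ v₂ : ℝ × ℝ → ℝ × ℝ} {f₁ φ₁ f₂ φ₂ : ℝ × ℝ → ℝ}

/-- `φ = 0` off `Ū`. [folklore] -/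
theorem φ_eq_zero_of_notMem {U : Set (ℝ × ℝ)} {v : ℝ × ℝ → ℝ × ℝ} {f φ : ℝ × ℝ → ℝ}
    (h : IsNSIStructure U v f φ) {q : ℝ × ℝ} (hq : q ∉ closure U) : φ q = 0 :=
  image_eq_zero_of_notMem_tsupport fun hq' => hq (subset_closure (h.tsupport_φ hq'))

/-- Off `Ū₂` the data of the second structure vanish on a whole neighbourhood, so the sum agrees
with the first structure there. [folklore] -/
theorem eqOn_add_compl (h₂ : IsNSIStructure U₂ v₂ f₂ φ₂) (g₁ : ℝ × ℝ → ℝ) :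
    EqOn (g₁ + f₂) g₁ (closure U₂)ᶜ := fun q hq => by
  simp [h₂.f_eq_zero hq]

/-- **The sum of two structures with disjoint closures is a structure** on the union (Ożański 2017,
§5.4 (5.25): "we obtain a structure `(v₁,f₁,φ₁)` on `U₁`" for `U₁ = U ∪ U^{a',r'} ∪ U^{a'',r''} ∪
U^{a,r}` with the entry-wise sums; §6.5 Step 4; Scheffer 1987, (4.32)–(4.33)).
[cite: Ozanski2017NSISingular, §5.4 (5.25) and §6.5 Step 4] [cite: Scheffer1987, §4 (4.32)–(4.33)] -/
theorem add (h₁ : IsNSIStructure U₁ v₁ f₁ φ₁) (h₂ : IsNSIStructure U₂ v₂ f₂ φ₂)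
    (hd : Disjoint (closure U₁) (closure U₂)) :
    IsNSIStructure (U₁ ∪ U₂) (v₁ + v₂) (f₁ + f₂) (φ₁ + φ₂) := by
  -- points of `Ū₁` are off `Ū₂` and conversely
  have h12 : ∀ {q}, q ∈ closure U₁ → q ∉ closure U₂ := fun hq hq' => hd.ne_of_mem hq hq' rfl
  have h21 : ∀ {q}, q ∈ closure U₂ → q ∉ closure U₁ := fun hq hq' => hd.ne_of_mem hq' hq rfl
  have hO₁ : IsOpen (closure U₂)ᶜ := isClosed_closure.isOpen_compl
  have hO₂ : IsOpen (closure U₁)ᶜ := isClosed_closure.isOpen_compl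
  -- the sum agrees with one summand off the closure of the other
  have ef₁ : EqOn (f₁ + f₂) f₁ (closure U₂)ᶜ := fun q hq => by simp [h₂.f_eq_zero hq]
  have ef₂ : EqOn (f₁ + f₂) f₂ (closure U₁)ᶜ := fun q hq => by simp [h₁.f_eq_zero hq]
  have ev₁ : ∀ k : ℝ × ℝ → ℝ, EqOn (fun q => q.1 * k ((v₁ + v₂) q)) (fun q => q.1 * k (v₁ q))
      (closure U₂)ᶜ := fun k q hq => by simp [h₂.v_eq_zero hq]
  have ev₂ : ∀ k : ℝ × ℝ → ℝ, EqOn (fun q => q.1 * k ((v₁ + v₂) q)) (fun q => q.1 * k (v₂ q))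
      (closure U₁)ᶜ := fun k q hq => by simp [h₁.v_eq_zero hq]
  refine
    { isOpen := h₁.isOpen.union h₂.isOpen
      isCompact_closure := by
        rw [closure_union]; exact h₁.isCompact_closure.union h₂.isCompact_closure
      closure_subset := by
        rw [closure_union]; exact union_subset h₁.closure_subset h₂.closure_subset
      v_smooth := h₁.v_smooth.add h₂.v_smooth
      f_smooth := h₁.f_smooth.add h₂.f_smooth
      φ_smooth := h₁.φ_smooth.add h₂.φ_smooth
      f_nonneg := fun q => add_nonneg (h₁.f_nonneg q) (h₂.f_nonneg q)
      φ_mem := fun q => ?_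
      tsupport_f := ?_
      tsupport_φ := ?_
      tsupport_v := ?_
      div_eq_zero := fun q hq => ?_
      sq_lt := fun q hq => ?_
      opL_pos := fun q hq hφ => ?_ }
  · -- `0 ≤ φ₁ + φ₂ ≤ 1`
    by_cases hq : q ∈ closure U₁
    · have : φ₂ q = 0 := h₂.φ_eq_zero_of_notMem (h12 hq)
      simpa [this] using h₁.φ_mem q
    · have : φ₁ q = 0 := h₁.φ_eq_zero_of_notMem hq
      simpa [this] using h₂.φ_mem q
  · -- `supp (f₁ + f₂) = Ū₁ ∪ Ū₂`
    rw [closure_union]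
    apply Subset.antisymm
    · calc tsupport (f₁ + f₂) ⊆ closure (support f₁ ∪ support f₂) := closure_mono (support_add _ _)
        _ = tsupport f₁ ∪ tsupport f₂ := closure_union
        _ ⊆ closure U₁ ∪ closure U₂ := union_subset_union h₁.tsupport_f.le h₂.tsupport_f.le
    · have hs₁ : support f₁ ⊆ support (f₁ + f₂) := fun q hq => by
        have hq' : q ∉ closure U₂ := h12 (h₁.tsupport_f ▸ subset_tsupport _ hq)
        rw [mem_support] at hq ⊢
        simpa [h₂.f_eq_zero hq'] using hq
      have hs₂ : support f₂ ⊆ support (f₁ + f₂) := fun q hq => by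
        have hq' : q ∉ closure U₁ := h21 (h₂.tsupport_f ▸ subset_tsupport _ hq)
        rw [mem_support] at hq ⊢
        simpa [h₁.f_eq_zero hq'] using hq
      rw [← h₁.tsupport_f, ← h₂.tsupport_f]
      exact union_subset (closure_mono hs₁) (closure_mono hs₂)
  · -- `supp (φ₁ + φ₂) ⊆ U₁ ∪ U₂`
    refine (closure_mono (support_add _ _)).trans ?_
    rw [closure_union]
    exact union_subset_union h₁.tsupport_φ h₂.tsupport_φ
  · -- `supp (v₁ + v₂) ⊆ {φ₁ + φ₂ = 1}`
    refine (closure_mono (support_add _ _)).trans ?_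
    rw [closure_union]
    rintro q (hq | hq)
    · have hU : q ∈ U₁ := h₁.tsupport_v_subset hq
      have : φ₂ q = 0 := h₂.φ_eq_zero_of_notMem (h12 (subset_closure hU))
      have h1 : φ₁ q = 1 := h₁.tsupport_v hq
      simp [this, h1]
    · have hU : q ∈ U₂ := h₂.tsupport_v_subset hq
      have : φ₁ q = 0 := h₁.φ_eq_zero_of_notMem (h21 (subset_closure hU))
      have h1 : φ₂ q = 1 := h₂.tsupport_v hq
      simp [this, h1]
  · -- `div (r (v₁ + v₂)) = 0` in `U₁ ∪ U₂`
    rcases hq with hq | hq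
    · have hq' : q ∈ (closure U₂)ᶜ := h12 (subset_closure hq)
      rw [derivR_congr_of_eqOn hO₁ (ev₁ Prod.fst) hq', derivZ_congr_of_eqOn hO₁ (ev₁ Prod.snd) hq']
      exact h₁.div_eq_zero q hq
    · have hq' : q ∈ (closure U₁)ᶜ := h21 (subset_closure hq)
      rw [derivR_congr_of_eqOn hO₂ (ev₂ Prod.fst) hq', derivZ_congr_of_eqOn hO₂ (ev₂ Prod.snd) hq']
      exact h₂.div_eq_zero q hq
  · -- `|v₁ + v₂| < f₁ + f₂` in `U₁ ∪ U₂`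
    rcases hq with hq | hq
    · have hq' : q ∉ closure U₂ := h12 (subset_closure hq)
      simpa [h₂.v_eq_zero hq', h₂.f_eq_zero hq'] using h₁.sq_lt q hq
    · have hq' : q ∉ closure U₁ := h21 (subset_closure hq)
      simpa [h₁.v_eq_zero hq', h₁.f_eq_zero hq'] using h₂.sq_lt q hq
  · -- `L(f₁ + f₂) > 0` off `{φ₁ + φ₂ = 1}`
    rcases hq with hq | hq
    · have hq' : q ∈ (closure U₂)ᶜ := h12 (subset_closure hq)
      have h0 : φ₂ q = 0 := h₂.φ_eq_zero_of_notMem hq'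
      have hφ₁ : φ₁ q ≠ 1 := by simpa [h0] using hφ
      rw [opL_congr_of_eqOn hO₁ ef₁ hq']
      exact h₁.opL_pos q hq hφ₁
    · have hq' : q ∈ (closure U₁)ᶜ := h21 (subset_closure hq)
      have h0 : φ₁ q = 0 := h₁.φ_eq_zero_of_notMem hq'
      have hφ₂ : φ₂ q ≠ 1 := by simpa [h0] using hφ
      rw [opL_congr_of_eqOn hO₂ ef₂ hq']
      exact h₂.opL_pos q hq hφ₂

/-- **The field of a disjoint sum is the sum of the fields**:
`u[v₁+v₂, f₁+f₂] = u[v₁,f₁] + u[v₂,f₂]` for structures on sets with disjoint closures (at every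
point at most one summand is non-zero). [cite: Ozanski2017NSISingular, §4.2 (4.25)–(4.26) and §5.4 (5.26)] -/
theorem swirlField_add (h₁ : IsNSIStructure U₁ v₁ f₁ φ₁) (h₂ : IsNSIStructure U₂ v₂ f₂ φ₂)
    (hd : Disjoint (closure U₁) (closure U₂)) :
    swirlField (v₁ + v₂) (f₁ + f₂) = swirlField v₁ f₁ + swirlField v₂ f₂ := by
  funext x
  by_cases hx : meridian x ∈ closure U₁
  · have hx' : meridian x ∉ closure U₂ := fun h' => hd.ne_of_mem hx h' rfl
    rw [Pi.add_apply, h₂.swirlField_eq_zero hx', add_zero]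
    simp only [swirlField, Pi.add_apply, h₂.v_eq_zero hx', h₂.f_eq_zero hx', add_zero]
  · rw [Pi.add_apply, h₁.swirlField_eq_zero hx, zero_add]
    simp only [swirlField, Pi.add_apply, h₁.v_eq_zero hx, h₁.f_eq_zero hx, zero_add]

/-- The two fields of a disjoint sum are disjointly supported. [folklore] -/
theorem swirlField_eq_zero_or (h₁ : IsNSIStructure U₁ v₁ f₁ φ₁) (h₂ : IsNSIStructure U₂ v₂ f₂ φ₂)
    (hd : Disjoint (closure U₁) (closure U₂)) (y : ℝ³) :
    swirlField v₁ f₁ y = 0 ∨ swirlField v₂ f₂ y = 0 := by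
  by_cases hy : meridian y ∈ closure U₁
  · exact Or.inr (h₂.swirlField_eq_zero fun h' => hd.ne_of_mem hy h' rfl)
  · exact Or.inl (h₁.swirlField_eq_zero hy)

/-- **The pressure of a disjoint sum is the sum of the pressures**:
`p*[u[v₁+v₂, f₁+f₂]] = p*[u[v₁,f₁]] + p*[u[v₂,f₂]]` (Ożański, Lemma 3.2 (iii); the tree's
`normalisedPressure_add_of_disjoint_of_contDiff`). [cite: Ozanski2017NSISingular, Lemma 3.2 (iii)] -/
theorem normalisedPressure_swirlField_add (h₁ : IsNSIStructure U₁ v₁ f₁ φ₁)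
    (h₂ : IsNSIStructure U₂ v₂ f₂ φ₂) (hd : Disjoint (closure U₁) (closure U₂)) :
    normalisedPressure (swirlField (v₁ + v₂) (f₁ + f₂)) =
      normalisedPressure (swirlField v₁ f₁) + normalisedPressure (swirlField v₂ f₂) := by
  rw [h₁.swirlField_add h₂ hd]
  exact normalisedPressure_add_of_disjoint_of_contDiff (h₁.swirlField_eq_zero_or h₂ hd)
    (h₁.contDiff_swirlField.of_le (by simp))
    (lintegral_enorm_sq_lt_top_of_hasCompactSupport h₁.contDiff_swirlField.continuous
      h₁.hasCompactSupport_swirlField)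
    (h₂.contDiff_swirlField.of_le (by simp))
    (lintegral_enorm_sq_lt_top_of_hasCompactSupport h₂.contDiff_swirlField.continuous
      h₂.hasCompactSupport_swirlField)

/-- **The planar pressure of a disjoint sum**: `p[v₁+v₂, f₁+f₂] = p[v₁,f₁] + p[v₂,f₂]`.
[cite: Ozanski2017NSISingular, Lemma 3.2 (iii) and §5.4 (5.26)] -/
theorem planePressure_add (h₁ : IsNSIStructure U₁ v₁ f₁ φ₁) (h₂ : IsNSIStructure U₂ v₂ f₂ φ₂)
    (hd : Disjoint (closure U₁) (closure U₂)) :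
    planePressure (v₁ + v₂) (f₁ + f₂) = planePressure v₁ f₁ + planePressure v₂ f₂ := by
  funext q
  simp only [planePressure, h₁.normalisedPressure_swirlField_add h₂ hd, Pi.add_apply]

/-- The planar pressure of the pure swirl of a disjoint sum: `p[0, f₁+f₂] = p[0,f₁] + p[0,f₂]`.
[cite: Ozanski2017NSISingular, Lemma 3.2 (iii)] -/
theorem planePressure_zero_add (h₁ : IsNSIStructure U₁ v₁ f₁ φ₁) (h₂ : IsNSIStructure U₂ v₂ f₂ φ₂)
    (hd : Disjoint (closure U₁) (closure U₂)) :
    planePressure 0 (f₁ + f₂) = planePressure 0 f₁ + planePressure 0 f₂ := by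
  have h := h₁.zero_field.planePressure_add h₂.zero_field hd
  rwa [add_zero] at h

/-- **Additivity of the pressure interaction function over disjoint sums** (Ożański 2017, §5.4
(5.26): `F* = F[v₁,f₁] = F + F^{a',r',s'} + F^{a'',r'',s''} + F^{a,r,s}`; §6.5 Step 4):
`F[v₁+v₂, f₁+f₂] = F[v₁,f₁] + F[v₂,f₂]` for structures on sets with disjoint closures.
[cite: Ozanski2017NSISingular, §5.4 (5.26)] [cite: Scheffer1987, §4 (4.32)–(4.33)] -/
theorem pressureInteraction_add (h₁ : IsNSIStructure U₁ v₁ f₁ φ₁) (h₂ : IsNSIStructure U₂ v₂ f₂ φ₂)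
    (hd : Disjoint (closure U₁) (closure U₂)) :
    pressureInteraction (v₁ + v₂) (f₁ + f₂) = pressureInteraction v₁ f₁ + pressureInteraction v₂ f₂ := by
  have hd₀₁ : Differentiable ℝ (planePressure 0 f₁) :=
    h₁.contDiff_planePressure_zero.differentiable (by simp)
  have hd₀₂ : Differentiable ℝ (planePressure 0 f₂) :=
    h₂.contDiff_planePressure_zero.differentiable (by simp)
  have hd₁ : Differentiable ℝ (planePressure v₁ f₁) := h₁.contDiff_planePressure.differentiable (by simp)
  have hd₂ : Differentiable ℝ (planePressure v₂ f₂) := h₂.contDiff_planePressure.differentiable (by simp)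
  funext q
  simp only [pressureInteraction, h₁.planePressure_add h₂ hd, h₁.planePressure_zero_add h₂ hd,
    Pi.add_apply, derivR, derivZ, fderiv_add (hd₀₁ q) (hd₀₂ q), fderiv_add (hd₁ q) (hd₂ q),
    _root_.add_apply, Prod.mk_add_mk, Prod.mk.injEq]
  constructor <;> ring

end IsNSIStructure

/-! ### Finite disjoint sums -/

/-- The empty structure (all data zero on `U = ∅`); the base case of finite sums. [folklore] -/
theorem IsNSIStructure.empty : IsNSIStructure (∅ : Set (ℝ × ℝ)) 0 0 0 where
  isOpen := isOpen_empty
  isCompact_closure := by rw [closure_empty]; exact isCompact_empty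
  closure_subset := by rw [closure_empty]; exact empty_subset _
  v_smooth := contDiff_const
  f_smooth := contDiff_const
  φ_smooth := contDiff_const
  f_nonneg := fun _ => le_rfl
  φ_mem := fun _ => ⟨le_rfl, zero_le_one⟩
  tsupport_f := by rw [closure_empty]; exact tsupport_zero
  tsupport_φ := by rw [tsupport_zero]
  tsupport_v := by rw [tsupport_zero]; exact empty_subset _
  div_eq_zero := fun _ hq => absurd hq (notMem_empty _)
  sq_lt := fun _ hq => absurd hq (notMem_empty _)
  opL_pos := fun _ hq => absurd hq (notMem_empty _)

/-- `F[0,0] = 0`. [folklore] -/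
@[simp] theorem pressureInteraction_zero_zero :
    pressureInteraction (0 : ℝ × ℝ → ℝ × ℝ) (0 : ℝ × ℝ → ℝ) = 0 := by
  funext q; simp [pressureInteraction]

section FinsetSum

variable {ι : Type*} {U : ι → Set (ℝ × ℝ)} {v : ι → ℝ × ℝ → ℝ × ℝ} {f φ : ι → ℝ × ℝ → ℝ}

/-- **A finite sum of structures on sets with pairwise disjoint closures is a structure** on the
union (Ożański 2017, §6.5 Step 4: the structure `(v₁,f₁,φ₁)` on
`U₁ = ⋃ₙ (U^{nX} ∪ U^{a'+nX,r'} ∪ U^{a''+nX,r''}) ∪ U^{a,r}`).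
[cite: Ozanski2017NSISingular, §6.5 Step 4] -/
theorem IsNSIStructure.finsetSum (s : Finset ι) (h : ∀ i ∈ s, IsNSIStructure (U i) (v i) (f i) (φ i))
    (hd : (s : Set ι).Pairwise fun i j => Disjoint (closure (U i)) (closure (U j))) :
    IsNSIStructure (⋃ i ∈ s, U i) (∑ i ∈ s, v i) (∑ i ∈ s, f i) (∑ i ∈ s, φ i) := by
  classical
  induction s using Finset.induction_on with
  | empty => simpa using IsNSIStructure.empty
  | @insert a s ha ih =>
    have h' : ∀ i ∈ s, IsNSIStructure (U i) (v i) (f i) (φ i) := fun i hi =>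
      h i (Finset.mem_insert_of_mem hi)
    have hd' : (s : Set ι).Pairwise fun i j => Disjoint (closure (U i)) (closure (U j)) :=
      hd.mono (by simp)
    have hS := ih h' hd'
    have hdisj : Disjoint (closure (U a)) (closure (⋃ i ∈ s, U i)) := by
      rw [Finset.closure_biUnion, disjoint_iUnion₂_right]
      intro i hi
      have hne : a ≠ i := fun h0 => ha (h0 ▸ hi)
      exact hd (Finset.mem_coe.2 (Finset.mem_insert_self a s))
        (Finset.mem_coe.2 (Finset.mem_insert_of_mem hi)) hne
    rw [Finset.set_biUnion_insert, Finset.sum_insert ha, Finset.sum_insert ha, Finset.sum_insert ha]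
    exact (h a (Finset.mem_insert_self a s)).add hS hdisj

/-- **Additivity of `F[v,f]` over finite disjoint sums**:
`F[Σᵢ vᵢ, Σᵢ fᵢ] = Σᵢ F[vᵢ,fᵢ]` (Ożański 2017, §6.5 Step 4:
`F* = Σₙ (F^{nX,1,1} + F^{a'+nX,r',s'} + F^{a''+nX,r'',s''}) + F^{a,r,s} = H* + F^{a,r,s}`).
[cite: Ozanski2017NSISingular, §6.5 Step 4] -/
theorem IsNSIStructure.pressureInteraction_finsetSum (s : Finset ι)
    (h : ∀ i ∈ s, IsNSIStructure (U i) (v i) (f i) (φ i))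
    (hd : (s : Set ι).Pairwise fun i j => Disjoint (closure (U i)) (closure (U j))) :
    pressureInteraction (∑ i ∈ s, v i) (∑ i ∈ s, f i) = ∑ i ∈ s, pressureInteraction (v i) (f i) := by
  classical
  induction s using Finset.induction_on with
  | empty => simp
  | @insert a s ha ih =>
    have h' : ∀ i ∈ s, IsNSIStructure (U i) (v i) (f i) (φ i) := fun i hi =>
      h i (Finset.mem_insert_of_mem hi)
    have hd' : (s : Set ι).Pairwise fun i j => Disjoint (closure (U i)) (closure (U j)) :=
      hd.mono (by simp)
    have hS := IsNSIStructure.finsetSum s h' hd'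
    have hdisj : Disjoint (closure (U a)) (closure (⋃ i ∈ s, U i)) := by
      rw [Finset.closure_biUnion, disjoint_iUnion₂_right]
      intro i hi
      have hne : a ≠ i := fun h0 => ha (h0 ▸ hi)
      exact hd (Finset.mem_coe.2 (Finset.mem_insert_self a s))
        (Finset.mem_coe.2 (Finset.mem_insert_of_mem hi)) hne
    rw [Finset.sum_insert ha, Finset.sum_insert ha, Finset.sum_insert ha,
      (h a (Finset.mem_insert_self a s)).pressureInteraction_add hS hdisj, ih h' hd']

end FinsetSum

end Literature.Barriers.NavierStokesRegularity
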